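import Literature.NumberTheory.GaloisRepresentations.ContinuousCohomologyMultiplicationSequences
import Literature.Algebra.Module.CharacterModuleCoNakayama
import HarnessLib

/-!
# Greenberg 2006, Prop. 3.2: the continuous cohomology of a cofinitely generated discrete module is
# cofinitely generated

Let `Λ` be a Noetherian commutative ring, adically complete for an ideal `I` of finite index
(e.g. a complete Noetherian local ring with finite residue field and `I = 𝔪`, in particular
`Λ = ℤ_p⟦T₁, …, T_m⟧`), `Γ` a compact topological group such that `Hⁿ(Γ, A)` is finite for every
finite discrete `Λ[Γ]`-module `A` killed by `I` and every `n` (Greenberg's standing hypothesis (F),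
§3 p. 358 L8–13: "This is so if (i) `G = G_{K_v}` … or if (ii) `G = Gal(K_Σ/K)`"), and `D` a discrete
`Λ`-module with a continuous `Λ`-linear `Γ`-action whose Pontryagin dual `D^∨`
(Mathlib `CharacterModule D`, the tree's untopologised dual) is finitely generated.  Then
`Hⁿ(Γ, D)^∨` is finitely generated for every `n`
(`ContinuousRep.module_finite_characterModule_continuousCohomology`) — Greenberg, *On the structure
of certain Galois cohomology groups*, Prop. 3.2, "For any `i ≥ 0`, `Hⁱ(G, D)` is a cofinitely
generated `R`-module", for Mathlib's continuous cohomology `continuousCohomology n ρ.toTopRep`.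

PROOF (print pp. 358–359, reorganised so that the coefficient ring is never changed): write
`I = (λ₀, …, λ_{g-1})` and prove by induction on `j ≤ g` the statement for all such `D` killed by
`λ_j, …, λ_{g-1}`.  For `j = 0`, `D = D[I]` is finite (`CharacterModuleCoNakayama`:
`finite_torsionBySet_of_module_finite`), so every `Hⁿ(Γ, D)` is finite by (F).  For `j → j + 1`,
`D[λ_j]` and `D/λ_jD` are killed by `λ_j, …` and have finitely generated duals, so by induction
`Hⁿ(Γ, D[λ_j])^∨`, `Hⁿ⁻¹(Γ, D/λ_jD)^∨` are finitely generated, hence so is `(Hⁿ(Γ, D)[λ_j])^∨`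
(`ContinuousCohomologyMultiplicationSequences`: the two `λ`-sequences and the kernel of the
composite); now `Hⁿ(Γ, D)[I] ⊆ Hⁿ(Γ, D)[λ_j]` is finite and `Hⁿ(Γ, D)` is `I`-power torsion
(cochains take finitely many values), so "by Nakayama's lemma (the version for compact
`R`-modules)" (`CharacterModule.module_finite_of_finite_torsionBySet`) `Hⁿ(Γ, D)^∨` is finitely
generated.

Universe: `Λ`, `Γ`, `D` in `Type` (the tree's Nakayama for duals, `CharacterModuleCoNakayama.lean`,
is stated there; so are the Galois groups of the tree).

## What is NOT here
The instantiations (i) `Γ = Γ_{K_v}` and (ii) `Γ = Gal(K_Σ/K)` of hypothesis (F), and the bridge to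
`Greenberg2016.IsCofinitelyGenerated` / the named fact
`Greenberg2006.prop32_cohomology_isCofinitelyGenerated` (sequel files).

## References
* R. Greenberg, *On the structure of certain Galois cohomology groups*, Doc. Math. Extra Vol.
  Coates (2006) 335–391, §3 A, Prop. 3.2 with proof (p. 358 L3–13, L35 – p. 359 L18). [Greenberg2006]
-/

noncomputable section

open CategoryTheory Limits

namespace Literature.NumberTheory.GaloisRepresentations

open _root_.TopRep _root_.ContRepresentation _root_.ContinuousCohomology
open Literature.Algebra.Module

namespace ContinuousRep

variable {Λ : Type} [CommRing Λ] [TopologicalSpace Λ] [IsNoetherianRing Λ]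
variable {Γ : Type} [Group Γ] [TopologicalSpace Γ] [IsTopologicalGroup Γ] [CompactSpace Γ]

omit [TopologicalSpace Λ] [IsNoetherianRing Λ] in
/-- A module whose dual is finitely generated and which is killed by every member of a generating
family of an ideal `I` of finite index is finite (`D = D[I]`, and `D[I]` is finite by
`CharacterModule.finite_torsionBySet_of_module_finite`). [cite: Greenberg2006, §3 A (proof of Prop. 3.2, p. 359 L1–3 "`D[λ] = D[𝔪]` and `D/λD = D/𝔪D` are both finite")] -/
theorem finite_of_forall_smul_eq_zero_of_module_finite_characterModule (I : Ideal Λ)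
    [Finite (Λ ⧸ I)] {g : ℕ} (lam : Fin g → Λ) (hlam : Ideal.span (Set.range lam) = I)
    {D : Type} [AddCommGroup D] [Module Λ D] [Module.Finite Λ (CharacterModule D)]
    (hD : ∀ (k : Fin g) (d : D), lam k • d = 0) : Finite D := by
  classical
  haveI := CharacterModule.finite_torsionBySet_of_module_finite (S := D) I
  refine Finite.of_surjective
    (fun x : Submodule.torsionBySet Λ D (I : Set Λ) => (x : D)) fun d => ⟨⟨d, ?_⟩, rfl⟩
  rw [Submodule.mem_torsionBySet_iff]
  rintro ⟨r, hr⟩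
  rw [SetLike.mem_coe, ← hlam] at hr
  obtain ⟨c, rfl⟩ := (Submodule.mem_span_range_iff_exists_fun Λ).1 hr
  rw [Finset.sum_smul]
  refine Finset.sum_eq_zero fun k _ => ?_
  rw [smul_eq_mul, mul_smul, hD, smul_zero]

/-- **Greenberg 2006, Prop. 3.2 (cofinite generation of cohomology), for Mathlib's continuous
cohomology.**  `Λ` Noetherian and `I`-adically complete with `Λ/I` finite; `Γ` compact with
`Hⁿ(Γ, A)` finite for all finite discrete `Λ[Γ]`-modules `A` killed by `I` and all `n` (print's
standing hypothesis, satisfied by `G_{K_v}` and `Gal(K_Σ/K)`); `D` discrete with continuous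
`Λ`-linear `Γ`-action and finitely generated Pontryagin dual.  Then the Pontryagin dual of
`Hⁿ(Γ, D)` is a finitely generated `Λ`-module, for every `n`.  PRINT: "Proposition 3.2. For any
`i ≥ 0`, `Hⁱ(G, D)` is a cofinitely generated `R`-module." (typed for the formal-power-series /
adically complete `R` of the tree's consumers; print: any complete Noetherian local `R` with finite
residue field — covered with `I = 𝔪`). [cite: Greenberg2006, Prop. 3.2 (p. 358 L37; proof p. 358 L38 – p. 359 L18)] -/
theorem module_finite_characterModule_continuousCohomology (I : Ideal Λ) [IsAdicComplete I Λ]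
    [Finite (Λ ⧸ I)]
    (hΓ : ∀ (A : Type) [AddCommGroup A] [Module Λ A] [TopologicalSpace A] [DiscreteTopology A]
      [ContinuousSMul Λ A] [Finite A] (τ : ContinuousRep Γ Λ A),
      (∀ r ∈ I, ∀ a : A, r • a = 0) → ∀ n : ℕ, Finite (continuousCohomology n τ.toTopRep))
    {D : Type} [AddCommGroup D] [Module Λ D] [TopologicalSpace D] [DiscreteTopology D]
    [ContinuousSMul Λ D] (ρ : ContinuousRep Γ Λ D) [Module.Finite Λ (CharacterModule D)]
    (n : ℕ) : Module.Finite Λ (CharacterModule (continuousCohomology n ρ.toTopRep)) := by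
  classical
  -- a finite generating family of `I`
  obtain ⟨g, lam, hlam⟩ :=
    Submodule.fg_iff_exists_fin_generating_family.1 (IsNoetherian.noetherian I)
  have hlamI : ∀ k : Fin g, lam k ∈ I := fun k => by
    rw [← hlam]; exact Submodule.subset_span ⟨k, rfl⟩
  have hIjac : I ≤ (⊥ : Ideal Λ).jacobson := IsAdicComplete.le_jacobson_bot I
  -- induction on `j`: the statement for all `D` killed by `λ_k`, `k ≥ j`
  suffices key : ∀ j : ℕ, j ≤ g →
      ∀ (D : Type) [AddCommGroup D] [Module Λ D] [TopologicalSpace D] [DiscreteTopology D]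
        [ContinuousSMul Λ D] (ρ : ContinuousRep Γ Λ D), Module.Finite Λ (CharacterModule D) →
        (∀ k : Fin g, j ≤ (k : ℕ) → ∀ d : D, lam k • d = 0) →
        ∀ n : ℕ, Module.Finite Λ (CharacterModule (continuousCohomology n ρ.toTopRep)) from
    key g le_rfl D ρ inferInstance (fun k hk => absurd hk (not_le.2 k.2)) n
  intro j
  induction j with
  | zero =>
    intro _ D _ _ _ _ _ ρ hDfg hkill n
    -- `D` is killed by `I`, hence finite, hence `Hⁿ(Γ, D)` is finite
    haveI := hDfg
    haveI : Finite D := finite_of_forall_smul_eq_zero_of_module_finite_characterModule I lam hlam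
      (fun k d => hkill k (Nat.zero_le _) d)
    have hI : ∀ r ∈ I, ∀ d : D, r • d = 0 := by
      intro r hr d
      rw [← hlam] at hr
      obtain ⟨c, rfl⟩ := (Submodule.mem_span_range_iff_exists_fun Λ).1 hr
      rw [Finset.sum_smul]
      refine Finset.sum_eq_zero fun k _ => ?_
      rw [smul_eq_mul, mul_smul, hkill k (Nat.zero_le _), smul_zero]
    haveI : Finite (continuousCohomology n ρ.toTopRep) := hΓ D ρ hI n
    haveI : Finite (CharacterModule (continuousCohomology n ρ.toTopRep)) :=
      (natCard_characterModule_le (M := continuousCohomology n ρ.toTopRep)).1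
    exact Module.Finite.of_finite
  | succ j ih =>
    intro hj D _ _ _ _ _ ρ hDfg hkill n
    haveI := hDfg
    have hj' : j < g := hj
    set l : Λ := lam ⟨j, hj'⟩ with hl
    -- `D` is `I`-power torsion
    have htorsD : ∀ d : D, ∃ k : ℕ, ∀ r ∈ I ^ k, r • d = 0 := fun d =>
      CharacterModule.exists_pow_smul_eq_zero_of_module_finite I hIjac d
    -- the submodule `D[l]`: finitely generated dual, killed by `λ_k` for `k ≥ j`
    let W₁ : Submodule Λ D := Submodule.torsionBy Λ D l
    haveI hW₁fg : Module.Finite Λ (CharacterModule W₁) :=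
      CharacterModule.module_finite_of_injective_of_module_finite W₁.subtype W₁.injective_subtype
    have hkill₁ : ∀ k : Fin g, j ≤ (k : ℕ) → ∀ w : W₁, lam k • w = 0 := by
      intro k hk w
      rcases Nat.eq_or_lt_of_le hk with hk | hk
      · apply Subtype.ext
        have hkj : k = ⟨j, hj'⟩ := Fin.ext hk.symm
        rw [Submodule.coe_smul, Submodule.coe_zero, hkj]
        exact (Submodule.mem_torsionBy_iff l (w : D)).1 w.2
      · exact Subtype.ext (by rw [Submodule.coe_smul, Submodule.coe_zero]; exact hkill k hk w)
    -- the quotient `D/lD`: finitely generated dual, killed by `λ_k` for `k ≥ j`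
    let W₂ : Submodule Λ D := LinearMap.range (DistribSMul.toLinearMap Λ D l)
    haveI hW₂fg : Module.Finite Λ (CharacterModule (D ⧸ W₂)) :=
      CharacterModule.module_finite_of_surjective_of_module_finite W₂.mkQ
        (Submodule.Quotient.mk_surjective W₂)
    have hkill₂ : ∀ k : Fin g, j ≤ (k : ℕ) → ∀ q : D ⧸ W₂, lam k • q = 0 := by
      intro k hk q
      induction q using Submodule.Quotient.induction_on with
      | _ d =>
        rw [← Submodule.Quotient.mk_smul, Submodule.Quotient.mk_eq_zero]
        rcases Nat.eq_or_lt_of_le hk with hk | hk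
        · have hkj : k = ⟨j, hj'⟩ := Fin.ext hk.symm
          rw [hkj]
          exact ⟨d, rfl⟩
        · rw [hkill k hk d]
          exact zero_mem _
    -- induction hypothesis for `D[l]` and `D/lD`, then the kernel-of-composite step
    have hsub := ih hj'.le W₁ (ρ.subrepresentation W₁ (ρ.torsionBy_smul_le_comap l)) hW₁fg
      hkill₁ n
    have hquot : ∀ m : ℕ, m + 1 = n → Module.Finite Λ (CharacterModule (continuousCohomology m
        (ρ.quotient W₂ (ρ.range_smul_le_comap l)).toTopRep)) := fun m _ =>
      ih hj'.le (D ⧸ W₂) (ρ.quotient W₂ (ρ.range_smul_le_comap l)) hW₂fg hkill₂ m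
    have hstep := ρ.module_finite_characterModule_torsionBy_continuousCohomology l n hsub hquot
    -- `Hⁿ(Γ, D)[I] ⊆ Hⁿ(Γ, D)[l]` is finite, `Hⁿ(Γ, D)` is `I`-power torsion: Nakayama
    set S := continuousCohomology n ρ.toTopRep
    haveI : Finite (Submodule.torsionBySet Λ (Submodule.torsionBy Λ S l) (I : Set Λ)) :=
      CharacterModule.finite_torsionBySet_of_module_finite I
    haveI : Finite (Submodule.torsionBySet Λ S (I : Set Λ)) := by
      refine Finite.of_injective (fun x : Submodule.torsionBySet Λ S (I : Set Λ) =>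
        (⟨⟨(x : S), ?_⟩, ?_⟩ : Submodule.torsionBySet Λ (Submodule.torsionBy Λ S l) (I : Set Λ)))
        ?_
      · rw [Submodule.mem_torsionBy_iff]
        exact (Submodule.mem_torsionBySet_iff _ _).1 x.2 ⟨l, hlamI ⟨j, hj'⟩⟩
      · rw [Submodule.mem_torsionBySet_iff]
        intro a
        apply Subtype.ext
        rw [Submodule.coe_smul, Submodule.coe_zero]
        exact (Submodule.mem_torsionBySet_iff _ _).1 x.2 a
      · intro x y hxy
        apply Subtype.ext
        exact congrArg (fun z : Submodule.torsionBySet Λ (Submodule.torsionBy Λ S l) (I : Set Λ)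
          => ((z : Submodule.torsionBy Λ S l) : S)) hxy
    exact CharacterModule.module_finite_of_finite_torsionBySet I (IsNoetherian.noetherian I)
      (ρ.exists_forall_mem_pow_smul_continuousCohomology_eq_zero I htorsD n)


/-! ### Truncated degrees (appended): hypothesis (F) in degrees `≤ N` gives the conclusion in
degrees `≤ N` -/

/-- **Greenberg 2006, Prop. 3.2 in degrees `≤ N` from hypothesis (F) in degrees `≤ N`.**  The
dévissage for `Hⁿ` only involves `Hⁿ` and `Hⁿ⁻¹` of subquotients, so if `Hⁿ(Γ, A)` is finite for
every finite discrete `Λ[Γ]`-module `A` killed by `I` and every `n ≤ N`, then the Pontryagin dual of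
`Hⁿ(Γ, D)` is finitely generated for every discrete `D` with finitely generated dual and every
`n ≤ N` (same `Λ`, `Γ` as in `module_finite_characterModule_continuousCohomology`).  Use: for
`Γ = Gal(K_Σ/K)` the finiteness input is available degree by degree (`H⁰`; `H¹` by Hermite–Minkowski;
`H²` = NSW (8.3.20)). [cite: Greenberg2006, Prop. 3.2 (proof, p. 358 L38 – p. 359 L18)] -/
theorem module_finite_characterModule_continuousCohomology_of_le (I : Ideal Λ)
    [IsAdicComplete I Λ] [Finite (Λ ⧸ I)] (N : ℕ)
    (hΓ : ∀ (A : Type) [AddCommGroup A] [Module Λ A] [TopologicalSpace A] [DiscreteTopology A]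
      [ContinuousSMul Λ A] [Finite A] (τ : ContinuousRep Γ Λ A),
      (∀ r ∈ I, ∀ a : A, r • a = 0) → ∀ n ≤ N, Finite (continuousCohomology n τ.toTopRep))
    {D : Type} [AddCommGroup D] [Module Λ D] [TopologicalSpace D] [DiscreteTopology D]
    [ContinuousSMul Λ D] (ρ : ContinuousRep Γ Λ D) [Module.Finite Λ (CharacterModule D)]
    {n : ℕ} (hn : n ≤ N) :
    Module.Finite Λ (CharacterModule (continuousCohomology n ρ.toTopRep)) := by
  classical
  obtain ⟨g, lam, hlam⟩ :=
    Submodule.fg_iff_exists_fin_generating_family.1 (IsNoetherian.noetherian I)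
  have hlamI : ∀ k : Fin g, lam k ∈ I := fun k => by
    rw [← hlam]; exact Submodule.subset_span ⟨k, rfl⟩
  have hIjac : I ≤ (⊥ : Ideal Λ).jacobson := IsAdicComplete.le_jacobson_bot I
  suffices key : ∀ j : ℕ, j ≤ g →
      ∀ (D : Type) [AddCommGroup D] [Module Λ D] [TopologicalSpace D] [DiscreteTopology D]
        [ContinuousSMul Λ D] (ρ : ContinuousRep Γ Λ D), Module.Finite Λ (CharacterModule D) →
        (∀ k : Fin g, j ≤ (k : ℕ) → ∀ d : D, lam k • d = 0) →
        ∀ n ≤ N, Module.Finite Λ (CharacterModule (continuousCohomology n ρ.toTopRep)) from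
    key g le_rfl D ρ inferInstance (fun k hk => absurd hk (not_le.2 k.2)) n hn
  intro j
  induction j with
  | zero =>
    intro _ D _ _ _ _ _ ρ hDfg hkill n hn
    haveI := hDfg
    haveI : Finite D := finite_of_forall_smul_eq_zero_of_module_finite_characterModule I lam hlam
      (fun k d => hkill k (Nat.zero_le _) d)
    have hI : ∀ r ∈ I, ∀ d : D, r • d = 0 := by
      intro r hr d
      rw [← hlam] at hr
      obtain ⟨c, rfl⟩ := (Submodule.mem_span_range_iff_exists_fun Λ).1 hr
      rw [Finset.sum_smul]
      refine Finset.sum_eq_zero fun k _ => ?_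
      rw [smul_eq_mul, mul_smul, hkill k (Nat.zero_le _), smul_zero]
    haveI : Finite (continuousCohomology n ρ.toTopRep) := hΓ D ρ hI n hn
    haveI : Finite (CharacterModule (continuousCohomology n ρ.toTopRep)) :=
      (natCard_characterModule_le (M := continuousCohomology n ρ.toTopRep)).1
    exact Module.Finite.of_finite
  | succ j ih =>
    intro hj D _ _ _ _ _ ρ hDfg hkill n hn
    haveI := hDfg
    have hj' : j < g := hj
    set l : Λ := lam ⟨j, hj'⟩ with hl
    have htorsD : ∀ d : D, ∃ k : ℕ, ∀ r ∈ I ^ k, r • d = 0 := fun d =>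
      CharacterModule.exists_pow_smul_eq_zero_of_module_finite I hIjac d
    let W₁ : Submodule Λ D := Submodule.torsionBy Λ D l
    haveI hW₁fg : Module.Finite Λ (CharacterModule W₁) :=
      CharacterModule.module_finite_of_injective_of_module_finite W₁.subtype W₁.injective_subtype
    have hkill₁ : ∀ k : Fin g, j ≤ (k : ℕ) → ∀ w : W₁, lam k • w = 0 := by
      intro k hk w
      rcases Nat.eq_or_lt_of_le hk with hk | hk
      · apply Subtype.ext
        have hkj : k = ⟨j, hj'⟩ := Fin.ext hk.symm
        rw [Submodule.coe_smul, Submodule.coe_zero, hkj]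
        exact (Submodule.mem_torsionBy_iff l (w : D)).1 w.2
      · exact Subtype.ext (by rw [Submodule.coe_smul, Submodule.coe_zero]; exact hkill k hk w)
    let W₂ : Submodule Λ D := LinearMap.range (DistribSMul.toLinearMap Λ D l)
    haveI hW₂fg : Module.Finite Λ (CharacterModule (D ⧸ W₂)) :=
      CharacterModule.module_finite_of_surjective_of_module_finite W₂.mkQ
        (Submodule.Quotient.mk_surjective W₂)
    have hkill₂ : ∀ k : Fin g, j ≤ (k : ℕ) → ∀ q : D ⧸ W₂, lam k • q = 0 := by
      intro k hk q
      induction q using Submodule.Quotient.induction_on with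
      | _ d =>
        rw [← Submodule.Quotient.mk_smul, Submodule.Quotient.mk_eq_zero]
        rcases Nat.eq_or_lt_of_le hk with hk | hk
        · have hkj : k = ⟨j, hj'⟩ := Fin.ext hk.symm
          rw [hkj]
          exact ⟨d, rfl⟩
        · rw [hkill k hk d]
          exact zero_mem _
    have hsub := ih hj'.le W₁ (ρ.subrepresentation W₁ (ρ.torsionBy_smul_le_comap l)) hW₁fg
      hkill₁ n hn
    have hquot : ∀ m : ℕ, m + 1 = n → Module.Finite Λ (CharacterModule (continuousCohomology m
        (ρ.quotient W₂ (ρ.range_smul_le_comap l)).toTopRep)) := fun m hm =>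
      ih hj'.le (D ⧸ W₂) (ρ.quotient W₂ (ρ.range_smul_le_comap l)) hW₂fg hkill₂ m (by omega)
    have hstep := ρ.module_finite_characterModule_torsionBy_continuousCohomology l n hsub hquot
    set S := continuousCohomology n ρ.toTopRep
    haveI : Finite (Submodule.torsionBySet Λ (Submodule.torsionBy Λ S l) (I : Set Λ)) :=
      CharacterModule.finite_torsionBySet_of_module_finite I
    haveI : Finite (Submodule.torsionBySet Λ S (I : Set Λ)) := by
      refine Finite.of_injective (fun x : Submodule.torsionBySet Λ S (I : Set Λ) =>
        (⟨⟨(x : S), ?_⟩, ?_⟩ : Submodule.torsionBySet Λ (Submodule.torsionBy Λ S l) (I : Set Λ)))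
        ?_
      · rw [Submodule.mem_torsionBy_iff]
        exact (Submodule.mem_torsionBySet_iff _ _).1 x.2 ⟨l, hlamI ⟨j, hj'⟩⟩
      · rw [Submodule.mem_torsionBySet_iff]
        intro a
        apply Subtype.ext
        rw [Submodule.coe_smul, Submodule.coe_zero]
        exact (Submodule.mem_torsionBySet_iff _ _).1 x.2 a
      · intro x y hxy
        apply Subtype.ext
        exact congrArg (fun z : Submodule.torsionBySet Λ (Submodule.torsionBy Λ S l) (I : Set Λ)
          => ((z : Submodule.torsionBy Λ S l) : S)) hxy
    exact CharacterModule.module_finite_of_finite_torsionBySet I (IsNoetherian.noetherian I)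
      (ρ.exists_forall_mem_pow_smul_continuousCohomology_eq_zero I htorsD n)

end ContinuousRep

end Literature.NumberTheory.GaloisRepresentations

end
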